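import Mathlib
import Literature.Computability.QuantumComplexity.PauliParseval

/-!
# Route SymplecticPurity · item SymplecticPurityBound — Pauli-string algebra and the label map of
a Clifford unitary (helper file 1/5)

Helpers for `SymplecticPurityBound` (stmt-QuantumAdvantage-10729), over the Pauli vocabulary of
`Literature.Computability.QuantumComplexity.PauliExpansion` (Kempe–Regev–Unger–de Wolf §2):

* scalars through `tensorAll`; the commutation rule `σ_S σ_T = sgn(S,T) σ_T σ_S` with the
  **commutation sign** `sgn(S,T) = ∏ᵢ sign(Sᵢ,Tᵢ) ∈ {±1}` (the symplectic form on Pauli labels);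
* cancellation `a σ_S = b σ_T, b ≠ 0 ⟹ S = T` (trace orthogonality) and `σ_S σ_T ≠ 0`;
* products of two diagonal (`I`/`Z`) strings and of two strings with disjoint supports;
* the **label map of a semantic Clifford unitary**: a unitary `U` with a map `f` and phases `c`,
  `U σ_S U† = c(S) σ_{f(S)}`, `|c(S)| = 1` (this is how the route types Clifford frames; `f, c`
  are carried as hypotheses, no new definitions). We show: `f` is injective, hence bijective, fixes
  the identity string, preserves the commutation sign (is symplectic), is multiplicative on the
  products the counting uses, and Pauli expectations pull back along it
  (`|⟨Uχ| σ_{f T} |Uχ⟩| = |⟨χ| σ_T |χ⟩|`), so spectral masses of `Uχ` are reindexed sums over `χ`.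
-/

noncomputable section

set_option linter.dupNamespace false -- D-0017: single-problem summit ⇒ `QuantumAdvantage.QuantumAdvantage` by design

open Matrix Finset
open Literature.Computability.QuantumComplexity

namespace Summit.QuantumAdvantage.QuantumAdvantage.Theorems.SymplecticPurity

variable {ι : Type*} [Fintype ι] [DecidableEq ι]

/-! ## Scalars, commutation signs, cancellation -/

omit [DecidableEq ι] in
/-- Scalars come out of a tensor product: `⊗ᵢ (aᵢ Aᵢ) = (∏ᵢ aᵢ) · ⊗ᵢ Aᵢ`. -/
theorem tensorAll_smul (a : ι → ℂ) (A : ι → Matrix Bool Bool ℂ) :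
    tensorAll (fun i => a i • A i) = (∏ i, a i) • tensorAll A := by
  ext x y
  simp only [tensorAll_apply, Matrix.smul_apply, smul_eq_mul, Finset.prod_mul_distrib]

/-- One-qubit commutation rule: `σ_Q σ_P = sign(Q,P) · σ_P σ_Q`. -/
theorem pauli_mat_mul_mat_eq_sign_smul (Q P : Pauli) :
    Pauli.mat Q * Pauli.mat P = Pauli.sign Q P • (Pauli.mat P * Pauli.mat Q) := by
  calc Pauli.mat Q * Pauli.mat P
      = Pauli.mat Q * Pauli.mat P * Pauli.mat Q * Pauli.mat Q := by
        rw [Matrix.mul_assoc (Pauli.mat Q * Pauli.mat P), Pauli.mat_mul_self, Matrix.mul_one]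
    _ = (Pauli.sign Q P • Pauli.mat P) * Pauli.mat Q := by rw [Pauli.mat_mul_mat_mul_mat]
    _ = Pauli.sign Q P • (Pauli.mat P * Pauli.mat Q) := by rw [Matrix.smul_mul]

/-- Commutation rule for Pauli strings: `σ_S σ_T = sgn(S,T) · σ_T σ_S` with the commutation sign
`sgn(S,T) = ∏ᵢ sign(Sᵢ,Tᵢ)`. -/
theorem pauliString_mul_eq_sign_smul (S T : ι → Pauli) :
    pauliString S * pauliString T =
      (∏ i, Pauli.sign (S i) (T i)) • (pauliString T * pauliString S) := by
  rw [pauliString_eq, pauliString_eq, tensorAll_mul, tensorAll_mul, ← tensorAll_smul]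
  congr 1
  funext i
  exact pauli_mat_mul_mat_eq_sign_smul (S i) (T i)

/-- A product of two Pauli strings is a nonzero matrix. -/
theorem pauliString_mul_pauliString_ne_zero (S T : ι → Pauli) :
    pauliString S * pauliString T ≠ 0 := by
  intro h
  have h1 : pauliString S * pauliString T * pauliString T * pauliString S = 1 := by
    rw [Matrix.mul_assoc (pauliString S), pauliString_mul_self, Matrix.mul_one,
      pauliString_mul_self]
  rw [h, Matrix.zero_mul, Matrix.zero_mul] at h1
  have h2 := congrFun (congrFun h1 (fun _ => false)) (fun _ => false)
  simp at h2

/-- Cancelling a Pauli string: `a σ_S = b σ_T` with `b ≠ 0` forces `S = T`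
(trace orthogonality of the strings). -/
theorem eq_of_smul_pauliString_eq {S T : ι → Pauli} {a b : ℂ} (hb : b ≠ 0)
    (h : a • pauliString S = b • pauliString T) : S = T := by
  by_contra hST
  have h2 : a * (pauliString T * pauliString S).trace =
      b * (pauliString T * pauliString T).trace := by
    have := congrArg (fun M => (pauliString T * M).trace) h
    simpa only [Matrix.mul_smul, Matrix.trace_smul, smul_eq_mul] using this
  rw [trace_pauliString_mul_pauliString, trace_pauliString_mul_pauliString,
    if_neg (Ne.symm hST), if_pos rfl, mul_zero] at h2
  exact mul_ne_zero hb (pow_ne_zero _ two_ne_zero) h2.symm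

omit [DecidableEq ι] in
/-- Equal scalar multiples of a nonzero matrix have equal scalars. -/
theorem smul_left_cancel_of_ne_zero {M : Matrix (ι → Bool) (ι → Bool) ℂ} (hM : M ≠ 0) {a b : ℂ}
    (h : a • M = b • M) : a = b := by
  have h' : (a - b) • M = 0 := by rw [sub_smul, h, sub_self]
  rcases smul_eq_zero.1 h' with h'' | h''
  · exact sub_eq_zero.1 h''
  · exact absurd h'' hM

/-! ## Products of special strings -/

/-- Products of diagonal letters: for `p, q ∈ {I, Z}`, `σ_p σ_q = σ_{p·q}` with `p·q = I` if
`p = q` and `Z` otherwise. -/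
theorem pauli_mat_mul_mat_of_IZ {p q : Pauli} (hp : p = Pauli.I ∨ p = Pauli.Z)
    (hq : q = Pauli.I ∨ q = Pauli.Z) :
    Pauli.mat p * Pauli.mat q = Pauli.mat (if p = q then Pauli.I else Pauli.Z) := by
  rcases hp with rfl | rfl <;> rcases hq with rfl | rfl
  · rw [if_pos rfl, Pauli.mat_mul_self]; rfl
  · rw [if_neg (by decide)]
    show 1 * Pauli.mat Pauli.Z = _
    rw [Matrix.one_mul]
  · rw [if_neg (by decide)]
    show Pauli.mat Pauli.Z * 1 = _
    rw [Matrix.mul_one]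
  · rw [if_pos rfl, Pauli.mat_mul_self]; rfl

/-- Products of diagonal strings: for `z, z' ∈ {I,Z}^ι`, `σ_z σ_{z'} = σ_{z·z'}` (no phase). -/
theorem pauliString_mul_of_IZ {z z' : ι → Pauli} (hz : ∀ i, z i = Pauli.I ∨ z i = Pauli.Z)
    (hz' : ∀ i, z' i = Pauli.I ∨ z' i = Pauli.Z) :
    pauliString z * pauliString z' =
      pauliString (fun i => if z i = z' i then Pauli.I else Pauli.Z) := by
  rw [pauliString_eq, pauliString_eq, tensorAll_mul, pauliString_eq]
  congr 1
  funext i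
  exact pauli_mat_mul_mat_of_IZ (hz i) (hz' i)

/-- Products of strings with disjoint supports: if `S` lives on `A` and `T` off `A`, then
`σ_S σ_T` is the string that is `S` on `A` and `T` off `A` (no phase). -/
theorem pauliString_mul_of_disjoint {A : Finset ι} {S T : ι → Pauli} (hS : S ∈ stringsOn A)
    (hT : T ∈ stringsOn Aᶜ) :
    pauliString S * pauliString T = pauliString (fun i => if i ∈ A then S i else T i) := by
  rw [pauliString_eq, pauliString_eq, tensorAll_mul, pauliString_eq]
  congr 1
  funext i
  by_cases hi : i ∈ A
  · rw [if_pos hi, mem_stringsOn.1 hT i (fun h => (Finset.mem_compl.1 h) hi)]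
    show Pauli.mat (S i) * 1 = _
    rw [Matrix.mul_one]
  · rw [if_neg hi, mem_stringsOn.1 hS i hi]
    show 1 * Pauli.mat (T i) = _
    rw [Matrix.one_mul]

/-! ## The Pauli-label map of a semantic Clifford unitary -/


/-- Unit-modulus phases are nonzero. -/
theorem ne_zero_of_norm_eq_one {c : ℂ} (h : ‖c‖ = 1) : c ≠ 0 := by
  intro hc
  rw [hc, norm_zero] at h
  exact zero_ne_one h

/-- Undoing a conjugation: `U† (U M U†) U = M` when `U† U = 1`. -/
theorem conjTranspose_mul_conj_mul {U : Matrix (ι → Bool) (ι → Bool) ℂ} (hU : Uᴴ * U = 1)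
    (M : Matrix (ι → Bool) (ι → Bool) ℂ) : Uᴴ * (U * M * Uᴴ) * U = M := by
  simp only [← Matrix.mul_assoc]
  rw [hU, Matrix.one_mul, Matrix.mul_assoc, hU, Matrix.mul_one]

/-- Conjugation is multiplicative: `U (A B) U† = (U A U†)(U B U†)` when `U† U = 1`. -/
theorem conj_mul_eq {U : Matrix (ι → Bool) (ι → Bool) ℂ} (hU : Uᴴ * U = 1)
    (A B : Matrix (ι → Bool) (ι → Bool) ℂ) :
    U * (A * B) * Uᴴ = (U * A * Uᴴ) * (U * B * Uᴴ) := by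
  simp only [Matrix.mul_assoc]
  rw [← Matrix.mul_assoc Uᴴ U, hU, Matrix.one_mul]

/-- **The label map of a Clifford unitary is injective.** -/
theorem clifford_injective {U : Matrix (ι → Bool) (ι → Bool) ℂ} (hU : Uᴴ * U = 1)
    {f : (ι → Pauli) → (ι → Pauli)} {c : (ι → Pauli) → ℂ}
    (hf : ∀ S, ‖c S‖ = 1 ∧ U * pauliString S * Uᴴ = c S • pauliString (f S)) :
    Function.Injective f := by
  intro S T hST
  have hS := (hf S).2
  have hT := (hf T).2
  rw [hST] at hS
  have h1 : c T • (U * pauliString S * Uᴴ) = c S • (U * pauliString T * Uᴴ) := by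
    rw [hS, hT, smul_smul, smul_smul, mul_comm]
  have h3 := congrArg (fun M => Uᴴ * M * U) h1
  simp only [Matrix.mul_smul, Matrix.smul_mul, conjTranspose_mul_conj_mul hU] at h3
  exact eq_of_smul_pauliString_eq (ne_zero_of_norm_eq_one (hf S).1) h3

/-- **The label map of a Clifford unitary is a bijection** of the finite set of Pauli strings. -/
theorem clifford_bijective {U : Matrix (ι → Bool) (ι → Bool) ℂ} (hU : Uᴴ * U = 1)
    {f : (ι → Pauli) → (ι → Pauli)} {c : (ι → Pauli) → ℂ}
    (hf : ∀ S, ‖c S‖ = 1 ∧ U * pauliString S * Uᴴ = c S • pauliString (f S)) :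
    Function.Bijective f :=
  ⟨clifford_injective hU hf, Finite.surjective_of_injective (clifford_injective hU hf)⟩

/-- **The label map fixes the identity string.** -/
theorem clifford_map_I {U : Matrix (ι → Bool) (ι → Bool) ℂ} (hU' : U * Uᴴ = 1)
    {f : (ι → Pauli) → (ι → Pauli)} {c : (ι → Pauli) → ℂ}
    (hf : ∀ S, ‖c S‖ = 1 ∧ U * pauliString S * Uᴴ = c S • pauliString (f S)) :
    f (fun _ => Pauli.I) = fun _ => Pauli.I := by
  have h := (hf (fun _ => Pauli.I)).2
  rw [pauliString_const_I, Matrix.mul_one, hU'] at h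
  have h' : (1 : ℂ) • pauliString (fun _ : ι => Pauli.I) =
      c (fun _ => Pauli.I) • pauliString (f fun _ => Pauli.I) := by
    rw [one_smul, pauliString_const_I]
    exact h
  exact (eq_of_smul_pauliString_eq (ne_zero_of_norm_eq_one (hf _).1) h').symm

/-- Conjugating a product of two strings. -/
theorem clifford_conj_mul {U : Matrix (ι → Bool) (ι → Bool) ℂ} (hU : Uᴴ * U = 1)
    {f : (ι → Pauli) → (ι → Pauli)} {c : (ι → Pauli) → ℂ}
    (hf : ∀ S, ‖c S‖ = 1 ∧ U * pauliString S * Uᴴ = c S • pauliString (f S)) (S T : ι → Pauli) :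
    U * (pauliString S * pauliString T) * Uᴴ =
      (c S * c T) • (pauliString (f S) * pauliString (f T)) := by
  rw [conj_mul_eq hU, (hf S).2, (hf T).2, Matrix.smul_mul, Matrix.mul_smul, smul_smul, mul_comm]

/-- **The label map preserves the commutation sign** (`f` is symplectic):
`sgn(f S, f T) = sgn(S, T)`. -/
theorem clifford_sign {U : Matrix (ι → Bool) (ι → Bool) ℂ} (hU : Uᴴ * U = 1)
    {f : (ι → Pauli) → (ι → Pauli)} {c : (ι → Pauli) → ℂ}
    (hf : ∀ S, ‖c S‖ = 1 ∧ U * pauliString S * Uᴴ = c S • pauliString (f S)) (S T : ι → Pauli) :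
    ∏ i, Pauli.sign (f S i) (f T i) = ∏ i, Pauli.sign (S i) (T i) := by
  have key := clifford_conj_mul hU hf S T
  have key' := clifford_conj_mul hU hf T S
  have h1 : (c S * c T) • (pauliString (f S) * pauliString (f T)) =
      (∏ i, Pauli.sign (S i) (T i)) • ((c T * c S) • (pauliString (f T) * pauliString (f S))) := by
    rw [← key, ← key', pauliString_mul_eq_sign_smul S T, Matrix.mul_smul, Matrix.smul_mul]
  rw [pauliString_mul_eq_sign_smul (f S) (f T), smul_smul, smul_smul] at h1
  have h2 := smul_left_cancel_of_ne_zero (pauliString_mul_pauliString_ne_zero _ _) h1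
  have hc : c S * c T ≠ 0 :=
    mul_ne_zero (ne_zero_of_norm_eq_one (hf S).1) (ne_zero_of_norm_eq_one (hf T).1)
  rw [mul_comm (c T) (c S), mul_comm (∏ i, Pauli.sign (S i) (T i))] at h2
  exact mul_left_cancel₀ hc h2

/-- **Multiplicativity on diagonal strings with separated images**: if `z, z' ∈ {I,Z}^ι` and
`f z` lives on `A`, `f z'` off `A`, then `f (z·z')` is `f z` on `A` and `f z'` off `A`. -/
theorem clifford_map_mul_of_IZ {U : Matrix (ι → Bool) (ι → Bool) ℂ} (hU : Uᴴ * U = 1)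
    {f : (ι → Pauli) → (ι → Pauli)} {c : (ι → Pauli) → ℂ}
    (hf : ∀ S, ‖c S‖ = 1 ∧ U * pauliString S * Uᴴ = c S • pauliString (f S))
    {A : Finset ι} {z z' : ι → Pauli} (hz : ∀ i, z i = Pauli.I ∨ z i = Pauli.Z)
    (hz' : ∀ i, z' i = Pauli.I ∨ z' i = Pauli.Z) (hA : f z ∈ stringsOn A)
    (hA' : f z' ∈ stringsOn Aᶜ) :
    f (fun i => if z i = z' i then Pauli.I else Pauli.Z) =
      fun i => if i ∈ A then f z i else f z' i := by
  have key := clifford_conj_mul hU hf z z'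
  rw [pauliString_mul_of_IZ hz hz', pauliString_mul_of_disjoint hA hA', (hf _).2] at key
  exact eq_of_smul_pauliString_eq
    (mul_ne_zero (ne_zero_of_norm_eq_one (hf z).1) (ne_zero_of_norm_eq_one (hf z').1)) key

/-! ## Pulling back expectations -/

/-- Unitaries preserve inner products: `⟨Uv, Uw⟩ = ⟨v, w⟩` when `U† U = 1`. -/
theorem star_mulVec_dotProduct_mulVec {U : Matrix (ι → Bool) (ι → Bool) ℂ} (hU : Uᴴ * U = 1)
    (v w : (ι → Bool) → ℂ) : star (U *ᵥ v) ⬝ᵥ (U *ᵥ w) = star v ⬝ᵥ w := by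
  rw [Matrix.star_mulVec, ← Matrix.dotProduct_mulVec, Matrix.mulVec_mulVec, hU, Matrix.one_mulVec]

/-- **Pull-back of Pauli expectations through a Clifford unitary**:
`|⟨Uχ| σ_{f T} |Uχ⟩| = |⟨χ| σ_T |χ⟩|`. -/
theorem norm_exp_clifford {U : Matrix (ι → Bool) (ι → Bool) ℂ} (hU : Uᴴ * U = 1)
    {f : (ι → Pauli) → (ι → Pauli)} {c : (ι → Pauli) → ℂ}
    (hf : ∀ S, ‖c S‖ = 1 ∧ U * pauliString S * Uᴴ = c S • pauliString (f S))
    (χ : (ι → Bool) → ℂ) (T : ι → Pauli) :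
    ‖star (U *ᵥ χ) ⬝ᵥ (pauliString (f T) *ᵥ (U *ᵥ χ))‖ = ‖star χ ⬝ᵥ (pauliString T *ᵥ χ)‖ := by
  have hc : c T ≠ 0 := ne_zero_of_norm_eq_one (hf T).1
  have h1 : pauliString (f T) = (c T)⁻¹ • (U * pauliString T * Uᴴ) := by
    rw [(hf T).2, smul_smul, inv_mul_cancel₀ hc, one_smul]
  have h2 : pauliString (f T) *ᵥ (U *ᵥ χ) = (c T)⁻¹ • (U *ᵥ (pauliString T *ᵥ χ)) := by
    rw [h1, Matrix.smul_mulVec, Matrix.mulVec_mulVec, Matrix.mul_assoc, hU, Matrix.mul_one,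
      ← Matrix.mulVec_mulVec]
  rw [h2, dotProduct_smul, star_mulVec_dotProduct_mulVec hU, smul_eq_mul, norm_mul, norm_inv,
    (hf T).1, inv_one, one_mul]

/-- **Reindexing along the label map**: summing `g ∘ f` over `f⁻¹(s)` is summing `g` over `s`. -/
theorem sum_filter_comp_clifford {U : Matrix (ι → Bool) (ι → Bool) ℂ} (hU : Uᴴ * U = 1)
    {f : (ι → Pauli) → (ι → Pauli)} {c : (ι → Pauli) → ℂ}
    (hf : ∀ S, ‖c S‖ = 1 ∧ U * pauliString S * Uᴴ = c S • pauliString (f S))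
    {M : Type*} [AddCommMonoid M] (s : Finset (ι → Pauli)) (g : (ι → Pauli) → M) :
    ∑ T ∈ Finset.univ.filter (fun T => f T ∈ s), g (f T) = ∑ Q ∈ s, g Q := by
  have step1 : ∑ Q ∈ s, g Q = ∑ Q, (if Q ∈ s then g Q else 0) := by
    rw [Finset.sum_ite_mem, Finset.univ_inter]
  rw [step1, Finset.sum_filter]
  exact (Equiv.ofBijective f (clifford_bijective hU hf)).sum_comp
    (fun Q => if Q ∈ s then g Q else 0)

/-- **Spectral mass pulls back along the label map**: the mass of `Uχ` on the strings supported
in `A` equals the mass of `χ` on `{T : f T ∈ 𝒫_A}`. -/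
theorem sum_stringsOn_norm_exp_sq_clifford {U : Matrix (ι → Bool) (ι → Bool) ℂ} (hU : Uᴴ * U = 1)
    {f : (ι → Pauli) → (ι → Pauli)} {c : (ι → Pauli) → ℂ}
    (hf : ∀ S, ‖c S‖ = 1 ∧ U * pauliString S * Uᴴ = c S • pauliString (f S))
    (χ : (ι → Bool) → ℂ) (A : Finset ι) :
    ∑ Q ∈ stringsOn A, ‖star (U *ᵥ χ) ⬝ᵥ (pauliString Q *ᵥ (U *ᵥ χ))‖ ^ 2 =
      ∑ T ∈ Finset.univ.filter (fun T => f T ∈ stringsOn A),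
        ‖star χ ⬝ᵥ (pauliString T *ᵥ χ)‖ ^ 2 := by
  rw [← sum_filter_comp_clifford hU hf (stringsOn A)
    (fun Q => ‖star (U *ᵥ χ) ⬝ᵥ (pauliString Q *ᵥ (U *ᵥ χ))‖ ^ 2)]
  exact Finset.sum_congr rfl fun T _ => by rw [norm_exp_clifford hU hf χ T]

end Summit.QuantumAdvantage.QuantumAdvantage.Theorems.SymplecticPurity

end
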